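import Literature.RingTheory.FormalGroups.FormalGroupInverse
import HarnessLib

/-!
# Negatives of homomorphisms of formal group laws: `Hom_R(F,G)` is an abelian group, `End_R(F)` a ring
# ([Hazewinkel 1978] §1.2 (1.2.5)–(1.2.6); [Silverman 2009] IV §2)

Topic `Literature/RingTheory/FormalGroups`; namespace `Literature.RingTheory.FormalGroups`.  DEFINITIONS + fully proved
theorems; no named fact, no instance, no notation, no `sorry`.  Cell `hodgecm-mathlib`, P6 «MOD programme» ROW 4B (sub-desk
F0P6d (G1) «`End F` as a ring under `F`-addition»).  Over: Mathlib `FormalGroup`, ★ `FormalGroupHom` (`comp`, `zero`, `map_add'`),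
`FormalGroupHomAdd` (`add`, interchange law, distributive laws), `FormalGroupInverse` (`negSeries`, two-sided inverse in every
currency, uniqueness).

## Contents

* `FormalGroupHom.negHom G` for `[G.IsComm]` — **`ι_G` is an endomorphism of `G`**: `ι(G(X,Y)) = G(ι X, ι Y)` (both sides are
  inverses of `G(X,Y)`, the right one by the interchange law; inverses are unique) — «`x ↦ −x` is a homomorphism iff the group is
  abelian».
* `FormalGroupHom.neg φ := negHom G ∘ φ` («`(−φ)(T) = ι_G(φ(T))`»), `neg_add : (−φ) + φ = 0`, `add_neg`, `neg_neg`, `neg_zero`,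
  `neg_add_distrib`, `comp_neg : χ ∘ (−φ) = −(χ ∘ φ)`, `neg_comp : (−ψ) ∘ χ = −(ψ ∘ χ)` — together with `FormalGroupHomAdd`
  (`add_comm∕add_assoc∕zero_add`, `comp_add∕add_comp`) and `FormalGroupHom` (`comp_assoc`, `id_comp`, `comp_id`) these are ALL the
  axioms of an abelian group on `Hom_R(F,G)` and of a ring on `End_R(F)` ([Hazewinkel1978] §1.2 (1.2.5)–(1.2.6)), as named theorems
  (no instance is declared in this definition file).
-/

noncomputable section

namespace Literature.RingTheory.FormalGroups

open _root_.MvPowerSeries (HasSubst subst)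

universe u

variable {R : Type u} [CommRing R]

/-! ## §3 Commutative laws: `ι` is an endomorphism; negatives of homomorphisms -/

namespace FormalGroupHom

open FormalGroupNeg

variable {F G : FormalGroup R}

variable (G) in
/-- For a COMMUTATIVE formal group law, **`ι_G` is an endomorphism**: `ι(G(X,Y)) = G(ι X, ι Y)` — both are inverses of `G(X,Y)`
(the second by the interchange law), and inverses are unique. [cite: Hazewinkel1978, §1.2 (1.2.5)] -/
def negHom [G.IsComm] : FormalGroupHom G G where
  toPowerSeries := negSeries G
  constantCoeff_eq_zero := constantCoeff_negSeries G
  map_add := by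
    have h0 : PowerSeries.HasSubst (MvPowerSeries.X 0 : MvPowerSeries (Fin 2) R) := PowerSeries.HasSubst.X 0
    have h1 : PowerSeries.HasSubst (MvPowerSeries.X 1 : MvPowerSeries (Fin 2) R) := PowerSeries.HasSubst.X 1
    have hι := hasSubst_negSeries G
    have hXY : G.toPowerSeries.subst ![MvPowerSeries.X 0, MvPowerSeries.X 1] = G.toPowerSeries := by
      have hX : (![MvPowerSeries.X 0, MvPowerSeries.X 1] : Fin 2 → MvPowerSeries (Fin 2) R) = MvPowerSeries.X := by
        funext i; fin_cases i <;> rfl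
      rw [hX, MvPowerSeries.subst_self]; rfl
    symm
    refine eq_negSeries_subst_of_subst_eq_zero G (hasSubst_formalGroup G)
      (hasSubst_formalGroup_subst G (hasSubst_powerSeries_subst hι h0) (hasSubst_powerSeries_subst hι h1)) ?_
    have hvec : (![G.toPowerSeries, G.toPowerSeries.subst ![PowerSeries.subst (MvPowerSeries.X 0 : MvPowerSeries (Fin 2) R) (negSeries G),
        PowerSeries.subst (MvPowerSeries.X 1 : MvPowerSeries (Fin 2) R) (negSeries G)]] : Fin 2 → MvPowerSeries (Fin 2) R) =
        ![G.toPowerSeries.subst ![MvPowerSeries.X 0, MvPowerSeries.X 1], G.toPowerSeries.subst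
          ![PowerSeries.subst (MvPowerSeries.X 0 : MvPowerSeries (Fin 2) R) (negSeries G),
            PowerSeries.subst (MvPowerSeries.X 1 : MvPowerSeries (Fin 2) R) (negSeries G)]] := by
      rw [hXY]
    rw [hvec, subst_pair_interchange G h0 h1 (hasSubst_powerSeries_subst hι h0) (hasSubst_powerSeries_subst hι h1),
      subst_self_negSeries G h0, subst_self_negSeries G h1, G.add_zero PowerSeries.HasSubst.zero]

/-- The series of `negHom G` is `ι_G`. [cite: Hazewinkel1978, §1.2 (1.2.5)] -/
@[simp] theorem negHom_toPowerSeries [G.IsComm] : (negHom G).toPowerSeries = negSeries G := rfl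

/-- **Negative of a homomorphism** into a commutative law: `(−φ)(T) := ι_G(φ(T))`, i.e. `−φ = ι_G ∘ φ`.
[cite: Hazewinkel1978, §1.2 (1.2.5)] -/
def neg [G.IsComm] (φ : FormalGroupHom F G) : FormalGroupHom F G := (negHom G).comp φ

/-- The series of `−φ` is `ι_G(φ(T))`. [cite: Hazewinkel1978, §1.2 (1.2.5)] -/
@[simp] theorem neg_toPowerSeries [G.IsComm] (φ : FormalGroupHom F G) :
    φ.neg.toPowerSeries = PowerSeries.subst φ.toPowerSeries (negSeries G) := rfl

/-- `(−φ) + φ = 0`. [cite: Hazewinkel1978, §1.2 (1.2.5)] -/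
theorem neg_add [G.IsComm] (φ : FormalGroupHom F G) : φ.neg.add φ = FormalGroupHom.zero F G := by
  ext1
  simp only [add_toPowerSeries, neg_toPowerSeries, zero_toPowerSeries]
  exact subst_negSeries_self G φ.hasSubst

/-- `φ + (−φ) = 0`. [cite: Hazewinkel1978, §1.2 (1.2.5)] -/
theorem add_neg [G.IsComm] (φ : FormalGroupHom F G) : φ.add φ.neg = FormalGroupHom.zero F G := by
  ext1
  simp only [add_toPowerSeries, neg_toPowerSeries, zero_toPowerSeries]
  exact subst_self_negSeries G φ.hasSubst

/-- `−(−φ) = φ` (uniqueness of inverses). [cite: Hazewinkel1978, §1.2 (1.2.5)] -/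
theorem neg_neg [G.IsComm] (φ : FormalGroupHom F G) : φ.neg.neg = φ := by
  ext1
  simp only [neg_toPowerSeries]
  exact (eq_negSeries_subst_of_subst_eq_zero G (hasSubst_powerSeries_subst (hasSubst_negSeries G) φ.hasSubst) φ.hasSubst (subst_negSeries_self G φ.hasSubst)).symm

/-- `−0 = 0`. [cite: Hazewinkel1978, §1.2 (1.2.5)] -/
theorem neg_zero [G.IsComm] : (FormalGroupHom.zero F G).neg = FormalGroupHom.zero F G := by
  rw [neg, comp_zero]

/-- `−(φ + ψ) = (−φ) + (−ψ)` (`ι_G` is a homomorphism). [cite: Hazewinkel1978, §1.2 (1.2.5)] -/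
theorem neg_add_distrib [G.IsComm] (φ ψ : FormalGroupHom F G) : (φ.add ψ).neg = φ.neg.add ψ.neg := by
  rw [neg, comp_add]; rfl

/-- `χ ∘ (−φ) = −(χ ∘ φ)` for a homomorphism `χ` between commutative laws. [cite: Hazewinkel1978, §1.2 (1.2.6)] -/
theorem comp_neg {H : FormalGroup R} [G.IsComm] [H.IsComm] (χ : FormalGroupHom G H) (φ : FormalGroupHom F G) :
    χ.comp φ.neg = (χ.comp φ).neg := by
  -- both are additive inverses of `χ ∘ φ`
  ext1
  simp only [comp_toPowerSeries, neg_toPowerSeries]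
  refine eq_negSeries_subst_of_subst_eq_zero H (χ.hasSubst_subst φ.hasSubst)
    (χ.hasSubst_subst (hasSubst_powerSeries_subst (hasSubst_negSeries G) φ.hasSubst)) ?_
  rw [← χ.map_add' φ.hasSubst (hasSubst_powerSeries_subst (hasSubst_negSeries G) φ.hasSubst), subst_self_negSeries G φ.hasSubst,
    PowerSeries.subst_zero_of_constantCoeff_zero χ.constantCoeff_eq_zero]

/-- `(−ψ) ∘ χ = −(ψ ∘ χ)` (substitution). [cite: Hazewinkel1978, §1.2 (1.2.6)] -/
theorem neg_comp {H : FormalGroup R} [H.IsComm] (ψ : FormalGroupHom G H) (χ : FormalGroupHom F G) :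
    ψ.neg.comp χ = (ψ.comp χ).neg := by
  rw [neg, neg, comp_assoc]

end FormalGroupHom



end Literature.RingTheory.FormalGroups
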